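import Mathlib
import HarnessLib
import Summits.AtomisticToContinuum.HydrodynamicLimit.Theses.EinsteinBathSolvent
import Literature.MathematicalPhysics.KineticTheory.OUExchangeHardSphereDynamics

/-!
# Crux `EinsteinBathEuler` (stmt-AtomisticToContinuum-17281) — birth skeleton (BC3), line `birth`

Route `route-AtomisticToContinuum-EinsteinBathSolvent`; crux (fixed, route decl)
`Summit.AtomisticToContinuum.HydrodynamicLimit.Theses.EinsteinBathSolvent.EinsteinBathEuler`:
for SOME exponents `(a, b)` in the window `0 < a < 1/3`, `0 < b < 2/3 − 2a` and a packing threshold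
`η₀ > 0`, the SPHERE fields of the bathed gas (the conjunct's `N+1` hard spheres of diameter
`ε_N = hsDiameter σ N` plus `K_N = ⌊(N+1)^(1−a)⌋` ideal point particles of mass `m_N = (N+1)^(−b)`,
a sphere–point `PolydisperseHardSphereFlow`, started from localGibbs ⊗ conditioned ideal light bath)
converge in probability, before the first shock, to the classical hard-sphere Euler solution.

This is the canonical first cut announced in the route's TWO-LAYER PLAN
("EinsteinBathEuler ⇐ BathReduction → NoisyOVYBathKernel → EinsteinBathEuler, k = 2"), which became
typable when the route's definition request landed as
`Literature.MathematicalPhysics.KineticTheory.OUExchangeHardSphereDynamics` (hard-sphere flow + a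
conservative, Lebesgue-reversible OU/divergence-form velocity exchange `ouExchange q` of pairs within
range `r`, intensity `γ`; a hypothesis structure extending `BathExchangeDynamics`, existence NOT a
field):

* `stub_bathReduction` (BATH REDUCTION UNIFORM IN `N`, XL — the typed form of the informal rank-4 item
  stmt-AtomisticToContinuum-12832): there are window exponents `(a, b)` such that for all continuous
  positive profiles there is `σ₀ > 0` with: for `0 < σ < σ₀` there are ADMISSIBLE noise data — a family
  of scalar fibre diffusivities `q_N(n, v, w)` pinched between two positive constants with bounded
  velocity gradient and smooth (uniform fibre ellipticity: Varadhan 1993 §5 p. 116 "enough vector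
  fields so that `L_{α,β}` is elliptic on the 2-dimensional manifolds"), a smooth compactly supported
  range profile `0 ≤ ψ ≤ 1` equal to `1` out to twice contact (range `r = ε_N`), and intensities
  `γ_N → ∞` with `γ_N ε_N → 0` (OVY's weak-noise regime `θ(ε) → ∞`, `εθ(ε) → 0`, Varadhan 1993 §5
  p. 117; here `γ_N ≍ N^(1/3−a−b/2)`, the Epstein randomisation rate, Spohn 1991 (8.62)) — such that
  for every hard-sphere flow family `Φ` (phase space of the local Gibbs law) and every sphere–point
  mixture flow family `Ψ` THERE IS an OU-exchange hard-sphere dynamics `S_N` with these data whose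
  time-`t` sphere-field statistics shadow those of the bathed spheres: at every `t ≥ 0`, for every
  continuous test function and every triple of target values, concentration in probability of the
  χ-tested density / momentum / energy fields of `S_N` (law `S_N.lawAt (localGibbsLaw) t`) implies the
  same concentration for the sphere component of `Ψ_N(t)` under the joint law. No Euler equation
  enters: this is closeness IN LAW of two microscopic dynamics (the light ideal bath, conditionally
  independent given the sphere paths, acts on the spheres as Epstein kicks — DurrGoldsteinLebowitz1981
  = Spohn1991 Thm 8.3, KusuokaLiang2010 — i.e. as a conservative exchange among spheres within the
  light mean free path), and the existence of the comparison dynamics (martingale problem for hard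
  spheres with an elliptic fibre diffusion) is part of the stub, so nothing downstream is vacuous.
* `stub_noisyEuler` (OVY FOR HARD SPHERES WITH AN ADMISSIBLE EXCHANGE NOISE, XL — the route's
  "NoisyOVYBathKernel"): there is a packing threshold `η₀ > 0` such that for all continuous positive
  profiles there is `σ₀ > 0` (depending on the profiles ONLY — statics) with: for `0 < σ < σ₀`, for
  EVERY admissible noise data `(q, ψ, γ)` as above, every classical hs-Euler solution on `[0, T)`
  obeying the packing guard `ρ_t(x) σ³ < η₀`, every `Φ` and every OU-exchange hard-sphere dynamics
  `S_N` with these data: if the local Gibbs fields converge at `t = 0` then at every `t ∈ [0, T)` the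
  empirical fields under `S_N.lawAt (localGibbsLaw) t` converge in probability to
  `(∫χρ_t, ∫χρ_t u_t, ∫χE_t)`. OllaVaradhanYau1993 Thm 2.1 / Cor 2.2 in their own noise regime,
  transplanted from the modified smooth Hamiltonian to hard spheres with the true kinetic energy
  (the HighMomentumCutoff barrier is this stub's open part: the bet recorded on the route is that an
  intensity `γ_N → ∞` supplies the large-velocity control; ergodic input LiveraniOlla1996 /
  FritzFunakiLebowitz1994 via the uniform fibre ellipticity of `q`).

`EinsteinBathEuler_of` is the pure-logic composition (no `sorry`): `η₀` from `stub_noisyEuler`,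
`(a, b)` from `stub_bathReduction`, `σ₀ := min σ_B σ_A` (the noisy-Euler threshold is fixed BEFORE the
noise data, so the reduction may choose its data after `σ`), the comparison dynamics `S` from the
reduction, the noisy Euler limit at `S`, and the transfer read at the Euler targets. The admissibility
predicate is the same inline `let ADM` in both stubs. Stub statements are the bodies of
`Stubs.stub_bathReduction` / `Stubs.stub_noisyEuler` (self-contained formulas over Literature
declarations; the `Stubs.` defs only give the skeleton theorem by-name hypotheses, as the A12 audit
wants). Disproof used: none on file for this crux (no `Disproof.lean`, no Negative lemmas; negatives
index of the summit checked 2026-08-17 — no statement about bathed or noisy hard-sphere dynamics).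
-/

namespace Summit.AtomisticToContinuum.HydrodynamicLimit.Cruxes.EinsteinBathEuler.Birth

open scoped BigOperators Topology Manifold Classical MeasureTheory ProbabilityTheory Matrix InnerProductSpace ComplexConjugate ContinuousMap
open Filter Set Function TopologicalSpace MeasureTheory

open Summit.AtomisticToContinuum.HydrodynamicLimit.Theses.EinsteinBathSolvent (EinsteinBathEuler)

/-! ### Stub statements (self-contained `Prop`s over Literature declarations) -/

/-- Statement of stub A — BATH REDUCTION UNIFORM IN `N` (closeness in law of the sphere-field
statistics of the bathed spheres to an OU-exchange hard-sphere dynamics with admissible data in OVY's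
weak-noise window; includes the existence of that comparison dynamics). Sources: Spohn1991 Thm 8.3
(8.62)–(8.63), DurrGoldsteinLebowitz1981, KusuokaLiang2010, DegondLucquinDesreux1996,
OllaVaradhanYau1993 §2.1, Varadhan 1993 (LNM 1551) §5 pp. 116–117. -/
def Stubs.stub_bathReduction : Prop :=
  let TT := Literature.MathematicalPhysics.KineticTheory.T3
  let VV := Literature.MathematicalPhysics.KineticTheory.V3
  let CFG : ℕ → Type := fun n => Literature.Analysis.FluidPDE.Config n (Fin 3) TT
  let G : Literature.Analysis.FluidPDE.Geometry (Fin 3) TT := Literature.Analysis.FluidPDE.Torus.geometry (Fin 3)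
  let D : TT → TT → ℝ := fun x y => ‖G.sepVec x y‖
  let MF : (n k : ℕ) → ℝ → ℝ → Type := fun n k e μ =>
    Literature.Analysis.FluidPDE.PolydisperseHardSphereFlow G
      (Fin.append (fun _ : Fin n => (1 : ℝ)) (fun _ : Fin k => μ))
      (Fin.append (fun _ : Fin n => e) (fun _ : Fin k => (0 : ℝ)))
  let PV := Literature.MathematicalPhysics.KineticTheory.PairVel (Fin 3)
  let OUD := fun (n : ℕ) (e : ℝ) (q : VV → PV → ℝ) (ψ : VV → ℝ) (g : ℝ) =>
    Literature.MathematicalPhysics.KineticTheory.OUExchangeHardSphereDynamics G e n q ψ e g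
  let ADM : ℝ → (ℕ → VV → PV → ℝ) → (VV → ℝ) → (ℕ → ℝ) → Prop := fun σ qf ψ γ =>
    (∃ q₁ C : ℝ, 0 < q₁ ∧ ∀ (N : ℕ) (n : VV) (p : PV),
        q₁ ≤ qf N n p ∧ qf N n p ≤ C ∧ ‖fderiv ℝ (qf N n) p‖ ≤ C) ∧
    (∀ N : ℕ, ContDiff ℝ (⊤ : ℕ∞) (Function.uncurry (qf N))) ∧
    ContDiff ℝ (⊤ : ℕ∞) ψ ∧ HasCompactSupport ψ ∧ (∀ n, 0 ≤ ψ n ∧ ψ n ≤ 1) ∧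
    (∀ n, ‖n‖ ≤ 2 → ψ n = 1) ∧
    (∀ N, 0 ≤ γ N) ∧ Filter.Tendsto γ Filter.atTop Filter.atTop ∧
    Filter.Tendsto (fun N => γ N * Literature.MathematicalPhysics.KineticTheory.hsDiameter σ N)
      Filter.atTop (nhds 0)
  ∃ a b : ℝ, 0 < a ∧ a < 1 / 3 ∧ 0 < b ∧ b < 2 / 3 - 2 * a ∧
  ∀ (a₀ θ₀ : TT → ℝ) (u₀ : TT → VV), Continuous a₀ → Continuous θ₀ → Continuous u₀ →
  (∀ x, 0 < a₀ x) → (∀ x, 0 < θ₀ x) →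
  ∃ σ₀ : ℝ, 0 < σ₀ ∧ ∀ σ : ℝ, 0 < σ → σ < σ₀ →
  let ε : ℕ → ℝ := fun N => Literature.MathematicalPhysics.KineticTheory.hsDiameter σ N
  ∃ (qf : ℕ → VV → PV → ℝ) (ψ : VV → ℝ) (γ : ℕ → ℝ), ADM σ qf ψ γ ∧
  ∀ Φ : (N : ℕ) → Literature.Analysis.FluidPDE.HardSphereFlow G (ε N) (N + 1),
  let K : ℕ → ℕ := fun N => ⌊((N : ℝ) + 1) ^ (1 - a)⌋₊
  let m : ℕ → ℝ := fun N => ((N : ℝ) + 1) ^ (-b)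
  let Tz : (ℕ → ENNReal) → Prop := fun f => Filter.Tendsto f Filter.atTop (nhds 0)
  let LG : (N : ℕ) → MeasureTheory.Measure (CFG (N + 1)) := fun N =>
    Literature.MathematicalPhysics.KineticTheory.localGibbsLaw σ a₀ u₀ θ₀ N (Φ N)
  let P : (N : ℕ) → MeasureTheory.Measure (CFG (N + 1 + K N)) := fun N =>
    MeasureTheory.Measure.map (fun x : CFG (N + 1) × CFG (K N) => (Fin.append x.1 x.2 : CFG (N + 1 + K N)))
      (((LG N).prod MeasureTheory.volume).withDensity (fun x => ENNReal.ofReal (∏ j,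
        (1 - Real.pi * σ ^ 3 / 6)⁻¹ * (if ∀ i, ε N / 2 < D (x.2 j).1 (x.1 i).1 then (1 : ℝ) else 0) *
          Literature.Analysis.FluidPDE.localMaxwellian 1 (θ₀ (x.2 j).1 / m N) (u₀ (x.2 j).1) (x.2 j).2)))
  let SPH : (N : ℕ) → CFG (N + 1 + K N) → CFG (N + 1) := fun N z i => z (Fin.castAdd (K N) i)
  ∀ Ψ : (N : ℕ) → MF (N + 1) (K N) (ε N) (m N),
  ∃ S : (N : ℕ) → OUD (N + 1) (ε N) (qf N) ψ (γ N),
  ∀ t : ℝ, 0 ≤ t → ∀ χ : TT → ℝ, Continuous χ → ∀ (cρ : ℝ) (cm : VV) (ce : ℝ),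
    (∀ δ : ℝ, 0 < δ →
      Tz (fun N => (S N).lawAt (LG N) t.toNNReal
        {z | δ < |Literature.MathematicalPhysics.KineticTheory.empiricalDensityField z χ - cρ|}) ∧
      Tz (fun N => (S N).lawAt (LG N) t.toNNReal
        {z | δ < ‖Literature.MathematicalPhysics.KineticTheory.empiricalMomentumField z χ - cm‖}) ∧
      Tz (fun N => (S N).lawAt (LG N) t.toNNReal
        {z | δ < |Literature.MathematicalPhysics.KineticTheory.empiricalEnergyField z χ - ce|})) →
    (∀ δ : ℝ, 0 < δ →
      Tz (fun N => P N {z | δ < |Literature.MathematicalPhysics.KineticTheory.empiricalDensityField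
        (SPH N ((Ψ N).flow t z)) χ - cρ|}) ∧
      Tz (fun N => P N {z | δ < ‖Literature.MathematicalPhysics.KineticTheory.empiricalMomentumField
        (SPH N ((Ψ N).flow t z)) χ - cm‖}) ∧
      Tz (fun N => P N {z | δ < |Literature.MathematicalPhysics.KineticTheory.empiricalEnergyField
        (SPH N ((Ψ N).flow t z)) χ - ce|}))

/-- Statement of stub B — OVY'S EULER LIMIT FOR HARD SPHERES WITH AN ADMISSIBLE CONSERVATIVE EXCHANGE
NOISE in the weak-noise window (packing-guarded; `σ₀` depends on the profiles only). Sources: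
OllaVaradhanYau1993 Thm 2.1 / Cor 2.2, §2.1 (2.4)–(2.7); Varadhan 1993 (LNM 1551) §5 pp. 116–117;
LiveraniOlla1996 §1; FritzFunakiLebowitz1994 §1.1; Spohn1991 Part I Ch. 3. -/
def Stubs.stub_noisyEuler : Prop :=
  let TT := Literature.MathematicalPhysics.KineticTheory.T3
  let VV := Literature.MathematicalPhysics.KineticTheory.V3
  let CFG : ℕ → Type := fun n => Literature.Analysis.FluidPDE.Config n (Fin 3) TT
  let G : Literature.Analysis.FluidPDE.Geometry (Fin 3) TT := Literature.Analysis.FluidPDE.Torus.geometry (Fin 3)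
  let PV := Literature.MathematicalPhysics.KineticTheory.PairVel (Fin 3)
  let OUD := fun (n : ℕ) (e : ℝ) (q : VV → PV → ℝ) (ψ : VV → ℝ) (g : ℝ) =>
    Literature.MathematicalPhysics.KineticTheory.OUExchangeHardSphereDynamics G e n q ψ e g
  let ADM : ℝ → (ℕ → VV → PV → ℝ) → (VV → ℝ) → (ℕ → ℝ) → Prop := fun σ qf ψ γ =>
    (∃ q₁ C : ℝ, 0 < q₁ ∧ ∀ (N : ℕ) (n : VV) (p : PV),
        q₁ ≤ qf N n p ∧ qf N n p ≤ C ∧ ‖fderiv ℝ (qf N n) p‖ ≤ C) ∧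
    (∀ N : ℕ, ContDiff ℝ (⊤ : ℕ∞) (Function.uncurry (qf N))) ∧
    ContDiff ℝ (⊤ : ℕ∞) ψ ∧ HasCompactSupport ψ ∧ (∀ n, 0 ≤ ψ n ∧ ψ n ≤ 1) ∧
    (∀ n, ‖n‖ ≤ 2 → ψ n = 1) ∧
    (∀ N, 0 ≤ γ N) ∧ Filter.Tendsto γ Filter.atTop Filter.atTop ∧
    Filter.Tendsto (fun N => γ N * Literature.MathematicalPhysics.KineticTheory.hsDiameter σ N)
      Filter.atTop (nhds 0)
  ∃ η₀ : ℝ, 0 < η₀ ∧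
  ∀ (a₀ θ₀ : TT → ℝ) (u₀ : TT → VV), Continuous a₀ → Continuous θ₀ → Continuous u₀ →
  (∀ x, 0 < a₀ x) → (∀ x, 0 < θ₀ x) →
  ∃ σ₀ : ℝ, 0 < σ₀ ∧ ∀ σ : ℝ, 0 < σ → σ < σ₀ →
  let ε : ℕ → ℝ := fun N => Literature.MathematicalPhysics.KineticTheory.hsDiameter σ N
  ∀ (qf : ℕ → VV → PV → ℝ) (ψ : VV → ℝ) (γ : ℕ → ℝ), ADM σ qf ψ γ →
  ∀ (T : ℝ) (ρ θ : ℝ → TT → ℝ) (u : ℝ → TT → VV),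
  Literature.MathematicalPhysics.KineticTheory.IsHardSphereEulerSolution σ T ρ u θ →
  (∀ t ∈ Set.Ico 0 T, ∀ x, ρ t x * σ ^ 3 < η₀) →
  ∀ Φ : (N : ℕ) → Literature.Analysis.FluidPDE.HardSphereFlow G (ε N) (N + 1),
  let Tz : (ℕ → ENNReal) → Prop := fun f => Filter.Tendsto f Filter.atTop (nhds 0)
  let LG : (N : ℕ) → MeasureTheory.Measure (CFG (N + 1)) := fun N =>
    Literature.MathematicalPhysics.KineticTheory.localGibbsLaw σ a₀ u₀ θ₀ N (Φ N)
  ∀ S : (N : ℕ) → OUD (N + 1) (ε N) (qf N) ψ (γ N),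
  Literature.MathematicalPhysics.KineticTheory.TendstoHydroFieldsAt LG Φ ρ u θ 0 →
  ∀ t ∈ Set.Ico 0 T, ∀ χ : TT → ℝ, Continuous χ → ∀ δ : ℝ, 0 < δ →
    Tz (fun N => (S N).lawAt (LG N) t.toNNReal
      {z | δ < |Literature.MathematicalPhysics.KineticTheory.empiricalDensityField z χ - ∫ y, χ y * ρ t y|}) ∧
    Tz (fun N => (S N).lawAt (LG N) t.toNNReal
      {z | δ < ‖Literature.MathematicalPhysics.KineticTheory.empiricalMomentumField z χ -
        ∫ y, (χ y * ρ t y) • u t y‖}) ∧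
    Tz (fun N => (S N).lawAt (LG N) t.toNNReal
      {z | δ < |Literature.MathematicalPhysics.KineticTheory.empiricalEnergyField z χ -
        ∫ y, χ y * Literature.MathematicalPhysics.KineticTheory.totalEnergyDensity (ρ t y) (u t y) (θ t y)|})

/-! ### Registered stubs (the open obligations of the line; `sorry` only here) -/

/-- STUB A (XL; the route's new content) — BATH REDUCTION UNIFORM IN `N`: the bathed spheres are
shadowed in law, at the level of χ-tested sphere-field statistics at each fixed time, by an
OU-exchange hard-sphere dynamics with admissible data in OVY's weak-noise window, which exists.
Why it might fail: lights ping-pong between spheres `O(ε)` apart (non-white, anisotropic exchange;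
shadowing), energy passes through the bath with `O(N^(1−a))` slack rather than pairwise, and
well-posedness of the noisy martingale problem with hard cores is itself unproved. -/
theorem stub_bathReduction : Stubs.stub_bathReduction := by
  sorry

/-- STUB B (XL; open but believed) — OVY'S EULER LIMIT FOR HARD SPHERES WITH ADMISSIBLE EXCHANGE NOISE:
OllaVaradhanYau1993 Thm 2.1 / Cor 2.2 with `θ(ε) = γ_N → ∞`, `εθ(ε) = γ_N ε_N → 0`, for the true
kinetic energy `|v|²/2` and hard-core collisions instead of a modified smooth Hamiltonian.
Why it might fail: the HighMomentumCutoff barrier (OVY needed a bounded-gradient kinetic energy even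
WITH noise, Varadhan 1993 §5 p. 116) — the large-velocity control must come from the noise itself. -/
theorem stub_noisyEuler : Stubs.stub_noisyEuler := by
  sorry

/-! ### Composition (PROVED): the two stubs give the crux BY NAME -/

/-- **The line concludes the crux BY NAME.** `Stubs.stub_bathReduction → Stubs.stub_noisyEuler →
EinsteinBathEuler` (pure logic, no `sorry`): `η₀` from the noisy Euler limit, `(a, b)` from the
reduction, `σ₀ := min σ_B σ_A`; for `σ` below it the reduction supplies admissible data `(q, ψ, γ)`
and, for the given `Φ, Ψ`, a comparison dynamics `S`; the noisy Euler limit at `S` (same `σ`, data,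
Euler solution, guard, `Φ`, initial law of large numbers) gives concentration of the noisy fields at
the Euler targets, and the reduction transfers it to the sphere component of the bathed gas. -/
theorem EinsteinBathEuler_of (hA : Stubs.stub_bathReduction) (hB : Stubs.stub_noisyEuler) :
    EinsteinBathEuler := by
  obtain ⟨η₀, hη₀, HB⟩ := hB
  obtain ⟨a, b, ha0, ha1, hb0, hb1, HA⟩ := hA
  refine ⟨η₀, hη₀, a, b, ha0, ha1, hb0, hb1, ?_⟩
  intro a₀ θ₀ u₀ hca hcθ hcu hpa hpθ
  obtain ⟨σ₁, hσ₁, HB'⟩ := HB a₀ θ₀ u₀ hca hcθ hcu hpa hpθ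
  obtain ⟨σ₂, hσ₂, HA'⟩ := HA a₀ θ₀ u₀ hca hcθ hcu hpa hpθ
  refine ⟨min σ₁ σ₂, lt_min hσ₁ hσ₂, ?_⟩
  intro σ hσ hσlt
  have h1 : σ < σ₁ := lt_of_lt_of_le hσlt (min_le_left _ _)
  have h2 : σ < σ₂ := lt_of_lt_of_le hσlt (min_le_right _ _)
  obtain ⟨qf, ψ, γ, hadm, HA''⟩ := HA' σ hσ h2
  intro ε T ρ θ u hE hG Φ K m Tz LG P SPH Ψ h0 t ht χ hχ
  obtain ⟨S, HS⟩ := HA'' Φ Ψ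
  have hN := HB' σ hσ h1 qf ψ γ hadm T ρ θ u hE hG Φ S h0 t ht χ hχ
  exact HS t ht.1 χ hχ _ _ _ hN

/-- Wiring check: the registered stubs feed `EinsteinBathEuler_of` as stated. -/
example : EinsteinBathEuler :=
  EinsteinBathEuler_of stub_bathReduction stub_noisyEuler

end Summit.AtomisticToContinuum.HydrodynamicLimit.Cruxes.EinsteinBathEuler.Birth
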